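import Summits.AnomalousDissipation.AnomalousDissipation.Theorems.SawtoothPulseCascadeK1LocalisedCascadeSlotWienerBound
import Summits.AnomalousDissipation.AnomalousDissipation.Theorems.SawtoothPulseCascadeK1LocalisedCascadeSmoothLeakage

/-!
# K1loc, line `Spectral` / SeqCone — helper: THE CARLSON BOUND FOR WIENER NORMS (S-B tool, sharp scaling)

Helper file of the prover lane on the crux `K1LocalisedCascade` (stmt-AnomalousDissipation-19491), route
`SawtoothPulseCascade` (memo v7 §3: the commutator / insertion / cross-term constants of the energy ledger are Wiener-type
moments `Σ_q ω(q)‖𝓕Θ(q)‖` of cut-off spectra; with `ω(q) ≤ L·|q_j|` they reduce to the Wiener norm `Σ_q |q_j|‖𝓕Θ(q)‖`,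
i.e. to `Σ_q ‖𝓕Θ′(q)‖/(2π)`).  `…SlotWienerBound.tsum_pow_mul_norm_mFourierCoeff_le` bounds such sums by TWO further
derivatives in sup norm, which for a cut-off with ramps of width `ℓ` scales like `ℓ⁻³` instead of the true `ℓ⁻¹`.
This file records the CARLSON(–Beurling) bound with the sharp scaling, as a pure sequence inequality on `ℤ`
(the consumer feeds Parseval): if `D q = 2πi q · c q` for all `q` (the coefficients of the derivative), then for every
integer `Q ≥ 1`
  `Σ_{q ≠ 0} ‖c q‖ ≤ √(2Q)·√(Σ‖c‖²) + √(Σ‖D‖²)/(π√(2Q))`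
(`tsum_norm_le_sqrt_mul_add`; Cauchy–Schwarz on `0 < |q| ≤ Q`, and `‖c q‖ = ‖D q‖/(2π|q|)` with `Σ_{|q|>Q} q⁻² ≤ 2/Q` beyond).
Choosing `2Q ≈ ‖f′‖₂/(π‖f‖₂)` gives `‖f‖_A ≲ |f̂(0)| + 2√(‖f‖₂‖f′‖₂/π)`: for a `1/N`-periodic cut-off with `4N` ramps of
relative width `ℓ_F` this is `O(N/ℓ_F) = O(1/ℓ)`, the true order (memo v7 §3, constant `A₀`).
Also: `tsum_inv_sq_tail_le` (`Σ_{|q|>Q} q⁻² ≤ 2/Q`).  No definitions; no statement about the stub.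
[cite: Grafakos2014, Prop. 3.2.7 (3) (Parseval) and Prop. 3.1.2 (coefficients of derivatives)] [problem: turb]
-/

-- `Summit.<Summit>.<Problem>`: single-conjunct summit, the duplicate namespace segment is deliberate.
set_option linter.dupNamespace false

noncomputable section

namespace Summit.AnomalousDissipation.AnomalousDissipation.Theorems.SawtoothPulseCascade.K1Slot

open Filter Topology Complex Finset

/-! ## §1 The tail of `Σ q⁻²` -/

/-- `Σ_{q > Q} 1/q² ≤ 1/Q` over the positive integers beyond `Q ≥ 1` (telescoping `1/q² ≤ 1/(q−1) − 1/q`). [folklore] -/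
theorem tsum_inv_sq_nat_tail_le {Q : ℕ} (hQ : 1 ≤ Q) :
    (Summable fun n : ℕ => (1 : ℝ) / ((n + Q + 1 : ℕ) : ℝ) ^ 2) ∧
      ∑' n : ℕ, (1 : ℝ) / ((n + Q + 1 : ℕ) : ℝ) ^ 2 ≤ 1 / (Q : ℝ) := by
  have hterm : ∀ n : ℕ, (1 : ℝ) / ((n + Q + 1 : ℕ) : ℝ) ^ 2 ≤
      1 / ((n + Q : ℕ) : ℝ) - 1 / ((n + Q + 1 : ℕ) : ℝ) := by
    intro n
    have h1 : (0 : ℝ) < ((n + Q : ℕ) : ℝ) := by exact_mod_cast (by omega : 0 < n + Q)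
    have h2 : (0 : ℝ) < ((n + Q + 1 : ℕ) : ℝ) := by positivity
    have h12 : ((n + Q + 1 : ℕ) : ℝ) = ((n + Q : ℕ) : ℝ) + 1 := by push_cast; ring
    rw [div_sub_div _ _ h1.ne' h2.ne', div_le_div_iff₀ (by positivity) (by positivity)]
    rw [h12]; nlinarith
  -- the telescoping series `Σ (a n − a (n+1))`, `a n = 1/(n+Q)`, sums to `a 0 = 1/Q`
  have ha : Tendsto (fun n : ℕ => (1 : ℝ) / ((n + Q : ℕ) : ℝ)) atTop (𝓝 0) :=
    (tendsto_const_div_atTop_nhds_zero_nat 1).comp (tendsto_add_atTop_nat Q)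
  have hnn_tel : ∀ n : ℕ, 0 ≤ (1 : ℝ) / ((n + Q : ℕ) : ℝ) - 1 / ((n + Q + 1 : ℕ) : ℝ) := fun n =>
    le_trans (by positivity) (hterm n)
  have htel : HasSum (fun n : ℕ => (1 : ℝ) / ((n + Q : ℕ) : ℝ) - 1 / ((n + Q + 1 : ℕ) : ℝ)) (1 / (Q : ℝ)) := by
    have hpart : ∀ N : ℕ, ∑ n ∈ Finset.range N, ((1 : ℝ) / ((n + Q : ℕ) : ℝ) - 1 / ((n + Q + 1 : ℕ) : ℝ)) =
        1 / (Q : ℝ) - 1 / ((N + Q : ℕ) : ℝ) := by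
      intro N
      induction N with
      | zero => simp
      | succ N ih =>
          rw [Finset.sum_range_succ, ih]
          have : ((N + 1 + Q : ℕ) : ℝ) = ((N + Q + 1 : ℕ) : ℝ) := by push_cast; ring
          rw [this]; ring
    rw [hasSum_iff_tendsto_nat_of_nonneg hnn_tel]
    simp_rw [hpart]
    have : Tendsto (fun N : ℕ => 1 / (Q : ℝ) - 1 / ((N + Q : ℕ) : ℝ)) atTop (𝓝 (1 / (Q : ℝ) - 0)) :=
      tendsto_const_nhds.sub ha
    rwa [sub_zero] at this
  have hnn : ∀ n : ℕ, 0 ≤ (1 : ℝ) / ((n + Q + 1 : ℕ) : ℝ) ^ 2 := fun n => by positivity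
  have hs : Summable fun n : ℕ => (1 : ℝ) / ((n + Q + 1 : ℕ) : ℝ) ^ 2 :=
    Summable.of_nonneg_of_le hnn hterm htel.summable
  exact ⟨hs, (hs.tsum_le_tsum hterm htel.summable).trans htel.tsum_eq.le⟩

/-! ## §2 The Carlson bound -/

/-- **Carlson's bound for the Wiener norm (sequence form).**  Let `c, D : ℤ → ℂ` with `D q = 2πi q · c q` for all `q`
(`D` = the Fourier coefficients of the derivative), `Σ‖c‖² < ∞`, `Σ‖D‖² < ∞`.  Then for every integer `Q ≥ 1`,
`‖c‖` is summable and `Σ_{q ≠ 0} ‖c q‖ ≤ √(2Q)·√(Σ‖c‖²) + √(Σ‖D‖²)/(π·√(2Q))`.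
[cite: Grafakos2014, Prop. 3.2.7 (3) and Prop. 3.1.2] -/
theorem tsum_norm_le_sqrt_mul_add {c D : ℤ → ℂ} (hc2 : Summable fun q => ‖c q‖ ^ 2)
    (hD2 : Summable fun q => ‖D q‖ ^ 2) (hD : ∀ q : ℤ, D q = (2 * Real.pi * Complex.I * q) * c q)
    {Q : ℕ} (hQ : 1 ≤ Q) :
    (Summable fun q => ‖c q‖) ∧
      ∑' q : ℤ, (if q = 0 then 0 else ‖c q‖) ≤
        Real.sqrt (2 * Q) * Real.sqrt (∑' q, ‖c q‖ ^ 2) + Real.sqrt (∑' q, ‖D q‖ ^ 2) / (Real.pi * Real.sqrt (2 * Q)) := by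
  have hπ : 0 < Real.pi := Real.pi_pos
  have hQpos : (0 : ℝ) < Q := by exact_mod_cast hQ
  -- `‖c q‖ = ‖D q‖ / (2π|q|)` for `q ≠ 0`
  have hcD : ∀ q : ℤ, q ≠ 0 → ‖c q‖ = ‖D q‖ / (2 * Real.pi * |(q : ℝ)|) := by
    intro q hq
    have hq' : (2 * Real.pi * |(q : ℝ)|) ≠ 0 := by
      have : (q : ℝ) ≠ 0 := by exact_mod_cast hq
      positivity
    have e1 : (2 * Real.pi * Complex.I * q : ℂ) = ((2 * Real.pi * (q : ℝ) : ℝ) : ℂ) * Complex.I := by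
      push_cast; try ring
    have e2 : ‖(2 * Real.pi * Complex.I * q : ℂ)‖ = 2 * Real.pi * |(q : ℝ)| := by
      rw [e1, norm_mul, Complex.norm_I, mul_one, Complex.norm_real, Real.norm_eq_abs, abs_mul,
        abs_of_pos (by positivity : (0 : ℝ) < 2 * Real.pi)]
    rw [hD q, norm_mul, e2]
    field_simp
  -- the three pieces of `ℤ`: `0`, `S₁ = {0 < |q| ≤ Q}`, `S₂ = {|q| > Q}`
  set S₁ : Finset ℤ := (Finset.Icc (-(Q : ℤ)) Q).erase 0 with hS₁
  have hS₁mem : ∀ q : ℤ, q ∈ S₁ ↔ q ≠ 0 ∧ |q| ≤ Q := by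
    intro q; simp only [hS₁, Finset.mem_erase, Finset.mem_Icc, abs_le]
  have hS₁card : (S₁.card : ℝ) ≤ 2 * Q := by
    have h : S₁.card = 2 * Q := by
      rw [hS₁, Finset.card_erase_of_mem (by simp), Int.card_Icc]
      have : ((Q : ℤ) + 1 - -(Q : ℤ)).toNat = 2 * Q + 1 := by omega
      rw [this]; omega
    rw [h]; push_cast; exact le_rfl
  set g₁ : ℤ → ℝ := fun q => if q ∈ S₁ then ‖c q‖ else 0 with hg₁
  set g₂ : ℤ → ℝ := fun q => if (Q : ℤ) < |q| then ‖c q‖ else 0 with hg₂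
  have hsplit : ∀ q : ℤ, (if q = 0 then 0 else ‖c q‖) = g₁ q + g₂ q := by
    intro q
    by_cases h0 : q = 0
    · simp [hg₁, hg₂, h0, hS₁mem, show ¬ ((Q : ℤ) < 0) from by omega]
    · by_cases hle : |q| ≤ Q
      · have h1 : q ∈ S₁ := (hS₁mem q).2 ⟨h0, hle⟩
        simp [hg₁, hg₂, h0, h1, not_lt.mpr hle]
      · have h1 : q ∉ S₁ := fun h => hle ((hS₁mem q).1 h).2
        simp [hg₁, hg₂, h0, h1, not_le.mp hle]
  -- `g₂` is dominated by `‖D q‖²/2 + 1/(8π² q²)` hence summable; and bounded via Cauchy–Schwarz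
  set wgt : ℤ → ℝ := fun q => if (Q : ℤ) < |q| then (1 / (2 * Real.pi * |(q : ℝ)|)) ^ 2 else 0 with hwgt
  have hwgt_nn : ∀ q, 0 ≤ wgt q := fun q => by simp only [hwgt]; split_ifs <;> positivity
  -- summability and sum of the weights: `Σ wgt ≤ 2/((2π)² Q)`
  have htail := tsum_inv_sq_nat_tail_le hQ
  have hwgt_sum : Summable wgt ∧ ∑' q, wgt q ≤ 2 / ((2 * Real.pi) ^ 2 * Q) := by
    -- split `ℤ` into `ℕ` and `-(ℕ+1)`
    set a : ℕ → ℝ := fun n => (1 : ℝ) / ((n + Q + 1 : ℕ) : ℝ) ^ 2 with ha_def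
    have hpos : ∀ n : ℕ, wgt (n : ℤ) = if Q < n then 1 / ((2 * Real.pi) ^ 2 * (n : ℝ) ^ 2) else 0 := by
      intro n
      have habs : |(n : ℤ)| = (n : ℤ) := abs_of_nonneg (by positivity)
      have habs' : |((n : ℤ) : ℝ)| = (n : ℝ) := by push_cast; exact abs_of_nonneg (by positivity)
      simp only [hwgt, habs, habs']
      by_cases h : Q < n
      · have hn : (0 : ℝ) < n := by exact_mod_cast (lt_of_le_of_lt (Nat.zero_le Q) h)
        rw [if_pos (by exact_mod_cast h), if_pos h]
        field_simp
      · rw [if_neg (by exact_mod_cast h), if_neg h]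
    have hneg : ∀ n : ℕ, wgt (-((n : ℤ) + 1)) = if Q < n + 1 then 1 / ((2 * Real.pi) ^ 2 * ((n : ℝ) + 1) ^ 2) else 0 := by
      intro n
      have habs : |(-((n : ℤ) + 1))| = (n : ℤ) + 1 := by rw [abs_neg]; exact abs_of_nonneg (by positivity)
      have habs' : |((-((n : ℤ) + 1) : ℤ) : ℝ)| = (n : ℝ) + 1 := by
        push_cast; rw [abs_neg]; exact abs_of_nonneg (by positivity)
      simp only [hwgt, habs, habs']
      by_cases h : Q < n + 1
      · rw [if_pos (by exact_mod_cast h), if_pos h]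
        field_simp
      · rw [if_neg (by exact_mod_cast h), if_neg h]
    -- both halves are shifts of `a`
    have hA : Summable a ∧ ∑' n, a n ≤ 1 / (Q : ℝ) := htail
    have hposS : Summable (fun n : ℕ => wgt (n : ℤ)) ∧ ∑' n : ℕ, wgt (n : ℤ) ≤ 1 / ((2 * Real.pi) ^ 2 * Q) := by
      have heq : (fun n : ℕ => wgt (n : ℤ)) = fun n => if Q < n then 1 / ((2 * Real.pi) ^ 2 * (n : ℝ) ^ 2) else 0 :=
        funext hpos
      rw [heq]
      -- reindex `n = m + Q + 1`
      have hshift : HasSum (fun n : ℕ => if Q < n then 1 / ((2 * Real.pi) ^ 2 * (n : ℝ) ^ 2) else (0 : ℝ))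
          (∑' m : ℕ, 1 / ((2 * Real.pi) ^ 2) * a m) := by
        have hs2 : Summable fun m : ℕ => 1 / ((2 * Real.pi) ^ 2) * a m := hA.1.mul_left _
        refine (hasSum_nat_add_iff' (Q + 1)).mp ?_
        have hzero : ∑ i ∈ Finset.range (Q + 1), (if Q < i then 1 / ((2 * Real.pi) ^ 2 * (i : ℝ) ^ 2) else (0 : ℝ)) = 0 :=
          Finset.sum_eq_zero fun i hi => by rw [if_neg (by simp at hi; omega)]
        rw [hzero, sub_zero]
        have hfun : (fun n : ℕ => if Q < n + (Q + 1) then 1 / ((2 * Real.pi) ^ 2 * ((n + (Q + 1) : ℕ) : ℝ) ^ 2) else (0 : ℝ)) =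
            fun m => 1 / ((2 * Real.pi) ^ 2) * a m := by
          funext m
          rw [if_pos (by omega), ha_def]
          simp only []
          have : ((m + (Q + 1) : ℕ) : ℝ) = ((m + Q + 1 : ℕ) : ℝ) := by push_cast; ring
          rw [this]
          have hpos' : (0 : ℝ) < ((m + Q + 1 : ℕ) : ℝ) := by positivity
          field_simp
        rw [hfun]; exact hs2.hasSum
      refine ⟨hshift.summable, ?_⟩
      rw [hshift.tsum_eq, tsum_mul_left]
      calc 1 / ((2 * Real.pi) ^ 2) * ∑' m, a m ≤ 1 / ((2 * Real.pi) ^ 2) * (1 / (Q : ℝ)) :=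
            mul_le_mul_of_nonneg_left hA.2 (by positivity)
        _ = 1 / ((2 * Real.pi) ^ 2 * Q) := by field_simp
    have hnegS : Summable (fun n : ℕ => wgt (-((n : ℤ) + 1))) ∧
        ∑' n : ℕ, wgt (-((n : ℤ) + 1)) ≤ 1 / ((2 * Real.pi) ^ 2 * Q) := by
      have heq : (fun n : ℕ => wgt (-((n : ℤ) + 1))) =
          fun n => if Q < n + 1 then 1 / ((2 * Real.pi) ^ 2 * ((n : ℝ) + 1) ^ 2) else 0 := funext hneg
      rw [heq]
      have hshift : HasSum (fun n : ℕ => if Q < n + 1 then 1 / ((2 * Real.pi) ^ 2 * ((n : ℝ) + 1) ^ 2) else (0 : ℝ))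
          (∑' m : ℕ, 1 / ((2 * Real.pi) ^ 2) * a m) := by
        have hs2 : Summable fun m : ℕ => 1 / ((2 * Real.pi) ^ 2) * a m := hA.1.mul_left _
        refine (hasSum_nat_add_iff' Q).mp ?_
        have hzero : ∑ i ∈ Finset.range Q, (if Q < i + 1 then 1 / ((2 * Real.pi) ^ 2 * ((i : ℝ) + 1) ^ 2) else (0 : ℝ)) = 0 :=
          Finset.sum_eq_zero fun i hi => by rw [if_neg (by simp at hi; omega)]
        rw [hzero, sub_zero]
        have hfun : (fun n : ℕ => if Q < n + Q + 1 then 1 / ((2 * Real.pi) ^ 2 * (((n + Q : ℕ) : ℝ) + 1) ^ 2) else (0 : ℝ)) =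
            fun m => 1 / ((2 * Real.pi) ^ 2) * a m := by
          funext m
          rw [if_pos (by omega), ha_def]
          simp only []
          have : ((m + Q : ℕ) : ℝ) + 1 = ((m + Q + 1 : ℕ) : ℝ) := by push_cast; ring
          rw [this]
          have hpos' : (0 : ℝ) < ((m + Q + 1 : ℕ) : ℝ) := by positivity
          field_simp
        rw [hfun]; exact hs2.hasSum
      refine ⟨hshift.summable, ?_⟩
      rw [hshift.tsum_eq, tsum_mul_left]
      calc 1 / ((2 * Real.pi) ^ 2) * ∑' m, a m ≤ 1 / ((2 * Real.pi) ^ 2) * (1 / (Q : ℝ)) :=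
            mul_le_mul_of_nonneg_left hA.2 (by positivity)
        _ = 1 / ((2 * Real.pi) ^ 2 * Q) := by field_simp
    have hS : HasSum wgt ((∑' n : ℕ, wgt (n : ℤ)) + ∑' n : ℕ, wgt (-((n : ℤ) + 1))) :=
      HasSum.of_nat_of_neg_add_one hposS.1.hasSum hnegS.1.hasSum
    refine ⟨hS.summable, ?_⟩
    rw [hS.tsum_eq]
    calc (∑' n : ℕ, wgt (n : ℤ)) + ∑' n : ℕ, wgt (-((n : ℤ) + 1))
        ≤ 1 / ((2 * Real.pi) ^ 2 * Q) + 1 / ((2 * Real.pi) ^ 2 * Q) := add_le_add hposS.2 hnegS.2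
      _ = 2 / ((2 * Real.pi) ^ 2 * Q) := by ring
  -- `g₂ q = √(wgt q) · ‖D q‖`
  have hg₂_eq : ∀ q, g₂ q = Real.sqrt (wgt q) * ‖D q‖ := by
    intro q
    simp only [hg₂, hwgt]
    by_cases h : (Q : ℤ) < |q|
    · have hq0 : q ≠ 0 := by intro h0; rw [h0, abs_zero] at h; exact absurd h (by omega)
      rw [if_pos h, if_pos h, hcD q hq0, Real.sqrt_sq (by positivity)]
      ring
    · rw [if_neg h, if_neg h, Real.sqrt_zero, zero_mul]
  -- Cauchy–Schwarz for `g₂`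
  have hCS := Summit.AnomalousDissipation.AnomalousDissipation.Theorems.SawtoothPulseCascade.SpectralLeakage.tsum_sq_le_tsum_mul_tsum
    (r := g₂) (f := wgt) (g := fun q => ‖D q‖ ^ 2) (fun q => by simp only [hg₂]; split_ifs <;> positivity) hwgt_nn
    (fun q => sq_nonneg _) hwgt_sum.1 hD2 (fun q => le_of_eq (by rw [hg₂_eq, mul_pow, Real.sq_sqrt (hwgt_nn q)]))
  have hg₂s : Summable g₂ := hCS.1
  have hg₂le : ∑' q, g₂ q ≤ Real.sqrt (∑' q, ‖D q‖ ^ 2) / (Real.pi * Real.sqrt (2 * Q)) := by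
    have h1 : ∑' q, g₂ q ≤ Real.sqrt ((∑' q, wgt q) * ∑' q, ‖D q‖ ^ 2) :=
      Real.le_sqrt_of_sq_le hCS.2
    have h2 : Real.sqrt ((∑' q, wgt q) * ∑' q, ‖D q‖ ^ 2) ≤
        Real.sqrt (2 / ((2 * Real.pi) ^ 2 * Q)) * Real.sqrt (∑' q, ‖D q‖ ^ 2) := by
      rw [Real.sqrt_mul (tsum_nonneg hwgt_nn)]
      exact mul_le_mul_of_nonneg_right (Real.sqrt_le_sqrt hwgt_sum.2) (Real.sqrt_nonneg _)
    have h3 : Real.sqrt (2 / ((2 * Real.pi) ^ 2 * Q)) = 1 / (Real.pi * Real.sqrt (2 * Q)) := by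
      have e : (2 : ℝ) / ((2 * Real.pi) ^ 2 * Q) = 1 / (Real.pi ^ 2 * (2 * Q)) := by
        rw [div_eq_div_iff (by positivity) (by positivity)]; ring
      rw [e, Real.sqrt_div' _ (by positivity), Real.sqrt_one, Real.sqrt_mul (sq_nonneg _), Real.sqrt_sq hπ.le]
    calc ∑' q, g₂ q ≤ Real.sqrt (2 / ((2 * Real.pi) ^ 2 * Q)) * Real.sqrt (∑' q, ‖D q‖ ^ 2) := h1.trans h2
      _ = Real.sqrt (∑' q, ‖D q‖ ^ 2) / (Real.pi * Real.sqrt (2 * Q)) := by rw [h3]; ring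
  -- the finite part `g₁`
  have hg₁s : Summable g₁ := by
    refine summable_of_ne_finset_zero (s := S₁) fun q hq => ?_
    simp [hg₁, hq]
  have hg₁le : ∑' q, g₁ q ≤ Real.sqrt (2 * Q) * Real.sqrt (∑' q, ‖c q‖ ^ 2) := by
    rw [tsum_eq_sum (s := S₁) (fun q hq => by simp [hg₁, hq])]
    have h1 : ∑ q ∈ S₁, g₁ q = ∑ q ∈ S₁, ‖c q‖ := Finset.sum_congr rfl fun q hq => by simp [hg₁, hq]
    rw [h1]
    -- Cauchy–Schwarz on the finite set
    have hcs : (∑ q ∈ S₁, ‖c q‖) ^ 2 ≤ (S₁.card : ℝ) * ∑ q ∈ S₁, ‖c q‖ ^ 2 := by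
      have h := Finset.sum_mul_sq_le_sq_mul_sq S₁ (fun _ => (1 : ℝ)) (fun q => ‖c q‖)
      simp only [one_pow, Finset.sum_const, nsmul_eq_mul, mul_one, one_mul] at h
      exact h
    have hfin : ∑ q ∈ S₁, ‖c q‖ ^ 2 ≤ ∑' q, ‖c q‖ ^ 2 :=
      hc2.sum_le_tsum S₁ fun q _ => sq_nonneg _
    have h0 : 0 ≤ ∑ q ∈ S₁, ‖c q‖ := Finset.sum_nonneg fun q _ => norm_nonneg _
    calc ∑ q ∈ S₁, ‖c q‖ = Real.sqrt ((∑ q ∈ S₁, ‖c q‖) ^ 2) := (Real.sqrt_sq h0).symm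
      _ ≤ Real.sqrt ((2 * Q) * ∑' q, ‖c q‖ ^ 2) :=
          Real.sqrt_le_sqrt (hcs.trans (mul_le_mul hS₁card hfin (Finset.sum_nonneg fun q _ => sq_nonneg _) (by positivity)))
      _ = Real.sqrt (2 * Q) * Real.sqrt (∑' q, ‖c q‖ ^ 2) := Real.sqrt_mul (by positivity) _
  -- summability of `‖c‖`
  have hc1 : Summable fun q => ‖c q‖ := by
    have h : ∀ q, ‖c q‖ = (if q = 0 then ‖c 0‖ else 0) + (g₁ q + g₂ q) := by
      intro q
      rw [← hsplit q]
      by_cases h0 : q = 0 <;> simp [h0]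
    have hs0 : Summable fun q : ℤ => (if q = 0 then ‖c 0‖ else (0 : ℝ)) :=
      summable_of_ne_finset_zero (s := {0}) fun q hq => by simp at hq; simp [hq]
    exact (hs0.add (hg₁s.add hg₂s)).congr fun q => (h q).symm
  refine ⟨hc1, ?_⟩
  calc ∑' q : ℤ, (if q = 0 then 0 else ‖c q‖) = ∑' q, (g₁ q + g₂ q) := tsum_congr hsplit
    _ = (∑' q, g₁ q) + ∑' q, g₂ q := hg₁s.tsum_add hg₂s
    _ ≤ Real.sqrt (2 * Q) * Real.sqrt (∑' q, ‖c q‖ ^ 2) + Real.sqrt (∑' q, ‖D q‖ ^ 2) / (Real.pi * Real.sqrt (2 * Q)) :=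
        add_le_add hg₁le hg₂le

end Summit.AnomalousDissipation.AnomalousDissipation.Theorems.SawtoothPulseCascade.K1Slot
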